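import Summits.BirchSwinnertonDyer.Rank1Residual.X4.KimConjectureIsogenyOptimal
import Summits.BirchSwinnertonDyer.Rank1Residual.Additive.X4RankZeroTamagawaParity
import HarnessLib

/-!
# The PARITY LAW for Kim's Tamagawa defect `∂^{(∞)}(δ̃)` at `p ≥ 5`, and what it buys: Conjecture 1.10
# may fail only by an EVEN amount; each half of the `p`-part of BSD tolerates a defect ONE OFF; the
# ONE-FACTOR socket for the TAM-DEFECT₂♭ rows (cell `b2b-bsdres`, seat additive-p4 gen 19, line V36;
# CLASS-CLOSURE §3.1/§3.2 experiment types E1 "exact missing statement" and E4 "anomaly detection")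

HONEST FRAMING (cell `b2b-bsdres`, run/shared/lean/b2b/bsd-rank1-residual/, verbatim in every
file): the goal of the cell is to DELETE the COMBINATION-SHAPED residual classes of the
Birch–Swinnerton-Dyer formula for ALL analytic-rank `≤ 1` elliptic curves over `ℚ` — "full BSD
formula for every rank `≤ 1` curve in class `C`" assembled STRICTLY from published theorems — so
that the rank-`≤ 1` remainder becomes exactly the CONSTRUCTION-SHAPED classes, which are TYPED
(missing-input `Prop`s), NOT attempted. This is not "finishing BSD". Sub-cell additive-p4 (X3♯/X4♯
direct): research route on the CONSTRUCTION-SHAPED class X4; the label X4 and the marks of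
RESIDUAL-MAP §I N10/N11 are UNCHANGED; nothing is booked. Theorems only (no definition, no named
fact minted). Published inputs are explicit named-fact HYPOTHESES: `hKimk` (Kim 2026 Thm. 1.8 (6)
lower reading, n1011-p11 p249207, flag `Kim-(6)-partial-reading`), `hE67c` (Kim 2026 Thm. 1.8 (6)
upper reading at cyclic levels, harvest-2 p250376, flag `Kim2026-(6)-cyclic-reading`), Cassels' theorem
`hCT = exists_casselsTate_pairing` (`#Ш` is a square once finite), GZK `hGZK`, modularity `hmod`.
Kim's Conjecture 1.10 appears only through n1011-p12's typed PREDICATES `X4.KimTamagawaDefect{Le,Ge,}At`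
and cc-typer-1's `X4.KimShaLengthRankZeroAt` — never assumed.

## What this file proves

Throughout: `W/ℚ` globally minimal, `p ≥ 5` with `ρ̄_{E,p}` onto, `L(E,1) ≠ 0`, a modular
parametrisation datum `D` at the conductor level with `p ∤ c_D` and the period transfer
`Ω(W) = u·Ω⁺_{D.f}`, `|u|_p = 1` (or `D` optimal, §4); ANY reduction type at `p`. Write
`d = ∂^{(∞)}(δ̃_{D.f})` (`kuriharaPartialInfty W p D.f`, finite by gen 17's
`kimShaLengthRankZeroAt_of_kimFacts_of_five_le`), `c = ord_p ∏_v c_v(W)`, `s = ord_p #Ш_an(E)`.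

* §1 **PARITY LAW** `even_padicValRat_sub_kimDefect_…`: `d ≡ ord_p(L(E,1)/Ω(W)) (mod 2)` (Kim's
  clause (6): `ord_p(L(E,1)/Ω(W)) = ord_p #Ш(p) + d`; Cassels: `ord_p #Ш` even); in BSD currency
  (`even_padicValRat_shaAn_add_tamagawa_sub_kimDefect_…`) **`d ≡ c + s (mod 2)`** — Conjecture 1.10
  (`d = c`) can only fail by an EVEN amount on rows with `s` even (`kimDefect_ne_tamagawa_add_one_…`,
  `kimDefect_add_one_ne_tamagawa_…`). E4 use: every census row of the Kurihara lanes must show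
  `∂^{(∞)} ≡ ord_p(L(E,1)/Ω_E) (mod 2)`; a violation is an engine error or a counterexample to a
  PUBLISHED theorem — an anomaly either way.
* §2 **ONE OFF IS ENOUGH** (per pair, class-free): on rows with `s` even, `c ≤ d + 1 ⟹
  MissingUpperBoundAt`, `d ≤ c + 1 ⟹ MissingLowerBoundAt`, both ⟹ `MissingPPartAt`; the typed `≥`
  half `X4.KimTamagawaDefectGeAt` FOLLOWS from its one-off relaxation on even rows.
* §3 **THE ONE-FACTOR SOCKET** for the TAM-DEFECT₂♭ rows (`p ∤ #Ш_an`, `c ≥ 2`; gen 14–18 residue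
  piece of X4♯): `bsdp_of_le_kimDefect_of_tamagawa_le_add_one_of_shaAn_unit` — ANY lower bound
  `α ≤ d` with `c ≤ α + 1` closes the row. The EXPECTED filler (NOT assumed; NOT in print as one
  statement — REQUESTS R17, V26-DESIGN.md): `α = max_{ℓ ≠ p} ord_p c_ℓ` from K. Büyükboduk,
  *Tamagawa defect of Euler systems*, J. Number Theory 129 (2009) 402–417, Cor. 3.3 ("`κ^Kato =
  p^α·κ^E`, `α ≥ ord_p(c_ℓ)`"; `p > 3`, `ρ_{E,p^∞}` onto, ONE prime `ℓ ≠ p`, no hypothesis on the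
  reduction at `p`) read through Kim's Thm. 3.13 (`ι∘exp*∘loc_p(κ^Kato_n) = u·p^t·δ̃_n`) on the rows
  with `t = length E(ℚ_p)[p^∞] = 0` — a composite READING of two sources, hence a socket. Census
  (seat file `V26-YIELD.tsv`, kit j118794, two engines for `c`): that `α` would close the 2 ‖ 0 window
  (N < 2·10⁴ ‖ 10⁴) TAM-DEFECT₂♭ rows at `p ≥ 5` (15050bb1 @ 5, 18150da1 @ 11) and 172 of the 177 S-b
  sweep rows (N < 5·10⁵; `t = 0`, slack `c − α ≤ 1`); 3 rows have `t = 1`, 2 have slack 2. EVIDENCE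
  only; nothing booked.
* §4 OPTIMAL data: the period transfer discharged by optimality (`periodTransfer_of_optimal`).

References: C.-H. Kim, Amer. J. Math. 148 (2026) 79–129 = arXiv:2203.12159v4 [Kim2022StructureSelmer]
Thm. 1.9 (= journal 1.8) (6), §1.5.1, Conj. 1.10, Thm. 3.13, Rem. 6.2; J. W. S. Cassels (1962) /
J. H. Silverman, *AEC* Thm. X.4.14 [SilvermanAEC2009]; R. L. Miller, LMS J. Comput. Math. 14 (2011)
Def. 1.1 [Miller2011LMS]; J. E. Cremona, *Algorithms* §2.8 [CremonaAlgorithms1997]; K. Büyükboduk,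
J. Number Theory 129 (2009) 402–417 = arXiv:0710.3858, Cor. 3.3 (prose citation; expected filler
only); cell files HOME/b2b-bsdres-additive-p4/V26-DESIGN.md, V26-YIELD.tsv, README §18–§21.
-/

noncomputable section

open scoped Classical MatrixGroups ModularForm

open Complex CongruenceSubgroup WeierstrassCurve Literature.NumberTheory.EllipticCurves
  Literature.NumberTheory.EllipticCurves.ModularForms
  Literature.NumberTheory.EllipticCurves.Rank1Residual
  Literature.NumberTheory.EllipticCurves.Rank1Residual.Typed

namespace Summit.BirchSwinnertonDyer.Rank1Residual.X4

/-- Parity bookkeeping in `ℤ`: two integers at distance `≤ 1` with even difference are equal on the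
relevant side — if `a ≤ b + 1` and `a - b` is even then `a ≤ b`. [folklore] -/
private theorem Int.le_of_le_add_one_of_even_sub {a b : ℤ} (h : a ≤ b + 1) (he : Even (a - b)) :
    a ≤ b := by
  rcases h.lt_or_eq with hlt | heq
  · omega
  · exfalso
    obtain ⟨k, hk⟩ := he
    omega

variable (W : WeierstrassCurve ℚ) [W.IsElliptic] [W.IsGloballyMinimal] (p : ℕ) [Fact p.Prime]

/-! ### §1 The parity law -/

omit [W.IsGloballyMinimal] in
/-- **Cassels' theorem in the `p`-primary currency**: once `Ш(E/ℚ)` is finite,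
`ord_p #Ш(E/ℚ)[p^∞]` is EVEN (`#Ш` is a perfect square, `hCT`). [cite: SilvermanAEC2009, Thm. X.4.14] -/
theorem even_padicValNat_card_shaPrimary_of_casselsTate
    (hCT : exists_casselsTate_pairing (K := ℚ)) (hfin : Finite W.sha) :
    Even (padicValNat p (Nat.card (AddCommGroup.primaryComponent W.sha p))) := by
  haveI : Finite W.sha := hfin
  obtain ⟨r, hr2⟩ := isSquare_shaOrder_of_casselsTate hCT W hfin
  have hn : W.shaOrder ≠ 0 := (WeierstrassCurve.shaOrder_pos W hfin).ne'
  have hr0 : r ≠ 0 := fun h ↦ hn (by simp [hr2, h])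
  rw [padicValNat_card_addPrimaryComponent, ← WeierstrassCurve.shaOrder, hr2, padicValNat.mul hr0 hr0]
  exact ⟨_, rfl⟩

/-- **THE PARITY LAW for Kim's Tamagawa defect at `p ≥ 5`: `∂^{(∞)}(δ̃) ≡ ord_p(L(E,1)/Ω(W)) (mod 2)`.**
For `W/ℚ` globally minimal, `p ≥ 5`, `ρ̄_{E,p}` onto, `L(E,1) ≠ 0`, `Ш` finite, a conductor-level
datum `D` with `p ∤ c_D` and the period transfer — ANY reduction at `p`: `L(E,1)/Ω(W) = q ∈ ℚ`,
`∂^{(∞)}(δ̃_{D.f}) = d ∈ ℕ`, and `ord_p q − d` is EVEN. Kim's clause (6) (`hKimk`, `hE67c`, via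
gen 17's `kimShaLengthRankZeroAt_of_kimFacts_of_five_le`) gives `ord_p q − d = ord_p #Ш(p)`, which is
even by Cassels (`hCT`). [cite: Kim2022StructureSelmer, Thm. 1.9 (6) (PDF p. 8), §1.5.1 (PDF p. 7)]
[cite: SilvermanAEC2009, Thm. X.4.14] -/
theorem even_padicValRat_sub_kimDefect_of_kimFacts_of_casselsTate_of_five_le
    (hKimk : Kim2026.rankZero_le_padicValNat_sha_of_kuriharaNumber_ne_zero)
    (hE67c : Kim2026.rankZero_padicValNat_sha_add_le_of_forall_pow_dvd_kuriharaNumber_cyclicLevel)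
    (hCT : exists_casselsTate_pairing (K := ℚ))
    (hp : 5 ≤ p) (hsurj : W.HasSurjectiveModNGaloisRep p) (hL : W.entireLFunction 1 ≠ 0)
    (hfin : Finite W.sha) {N : ℕ} [NeZero N] (D : ModularParametrizationData W N)
    (hN : W.conductorNorm ℤ = N) (hc : ¬ (p : ℤ) ∣ D.maninConstant)
    (hper : ∃ u : ℚ, ‖(u : ℚ_[p])‖ = 1 ∧ W.realPeriodRat = u * plusPeriod D.f) :
    ∃ (q : ℚ) (d : ℕ), W.entireLFunction 1 / (W.realPeriodRat : ℂ) = (q : ℂ) ∧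
      kuriharaPartialInfty W p D.f = d ∧ Even (padicValRat p q - d) := by
  obtain ⟨q, d, hq, hd, hval⟩ :=
    kimShaLengthRankZeroAt_of_kimFacts_of_five_le W p hKimk hE67c hp hsurj hL hfin D hc hper hN
  refine ⟨q, d, hq, hd, ?_⟩
  obtain ⟨k, hk⟩ := even_padicValNat_card_shaPrimary_of_casselsTate W p hCT hfin
  exact ⟨k, by rw [hval, hk, Nat.cast_add]; ring⟩

/-- **The parity law in BSD currency: `∂^{(∞)}(δ̃) ≡ ord_p ∏_v c_v + ord_p #Ш_an (mod 2)`.** Analytic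
rank `0` (modularity `hmod`), GZK (`hGZK`: rank `0`, `Ш` finite), `p ≥ 5` surjective, conductor-level
datum with `p ∤ c_D` and the period transfer: `#Ш_an(E) = q' ∈ ℚ`, `∂^{(∞)}(δ̃_{D.f}) = d ∈ ℕ` and
`ord_p q' + ord_p ∏_v c_v − d` is EVEN (`#Ш_an = (L(E,1)/Ω)·#tors²/∏c`, `p ∤ #tors` by irreducibility).
So Kim's Conjecture 1.10 (`d = ord_p ∏_v c_v`) fails, if at all, by an EVEN amount exactly when
`ord_p #Ш_an` is even. [cite: Kim2022StructureSelmer, Thm. 1.9 (6) and Conj. 1.10 (PDF p. 8)]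
[cite: SilvermanAEC2009, Thm. X.4.14] [cite: Miller2011LMS, Def. 1.1 (arXiv:1010.2431 p. 3)] -/
theorem even_padicValRat_shaAn_add_tamagawa_sub_kimDefect_of_kimFacts_of_casselsTate_of_five_le
    (hKimk : Kim2026.rankZero_le_padicValNat_sha_of_kuriharaNumber_ne_zero)
    (hE67c : Kim2026.rankZero_padicValNat_sha_add_le_of_forall_pow_dvd_kuriharaNumber_cyclicLevel)
    (hCT : exists_casselsTate_pairing (K := ℚ))
    (hGZK : rank_eq_analyticRank_of_analyticRank_le_one) (hmod : hasEntireLFunction_rat)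
    (hp : 5 ≤ p) (hr : W.analyticRank = 0) (hsurj : W.HasSurjectiveModNGaloisRep p)
    {N : ℕ} [NeZero N] (D : ModularParametrizationData W N) (hN : W.conductorNorm ℤ = N)
    (hc : ¬ (p : ℤ) ∣ D.maninConstant)
    (hper : ∃ u : ℚ, ‖(u : ℚ_[p])‖ = 1 ∧ W.realPeriodRat = u * plusPeriod D.f) :
    ∃ (q' : ℚ) (d : ℕ), shaAn W = (q' : ℂ) ∧ kuriharaPartialInfty W p D.f = d ∧
      Even (padicValRat p q' + padicValNat p W.tamagawaProduct - d) := by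
  have hL : W.entireLFunction 1 ≠ 0 := (W.analyticRank_eq_zero_iff_holds (hmod W)).mp hr
  obtain ⟨hmw, hfin⟩ := hGZK W (by rw [hr]; exact zero_le_one)
  obtain ⟨q, d, hq, hd, heven⟩ :=
    even_padicValRat_sub_kimDefect_of_kimFacts_of_casselsTate_of_five_le W p hKimk hE67c hCT hp hsurj
      hL hfin D hN hc hper
  obtain ⟨q', hq', hv'⟩ := shaAn_of_rankZero_value W p hmw hL
    (hasIrreducibleModPGaloisRep_of_hasSurjectiveModNGaloisRep W p hsurj) hq
  refine ⟨q', d, hq', hd, ?_⟩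
  rw [hv', sub_add_cancel]
  exact heven

/-- **Conjecture 1.10 never fails by `+1` on a row with `ord_p #Ш_an` even**: under §1's hypotheses,
if `#Ш_an = q'` with `ord_p q'` even then `∂^{(∞)}(δ̃) ≠ ord_p ∏_v c_v + 1`.
[cite: Kim2022StructureSelmer, Conj. 1.10 (PDF p. 8)] [cite: SilvermanAEC2009, Thm. X.4.14] -/
theorem kimDefect_ne_tamagawa_add_one_of_kimFacts_of_casselsTate_of_even
    (hKimk : Kim2026.rankZero_le_padicValNat_sha_of_kuriharaNumber_ne_zero)
    (hE67c : Kim2026.rankZero_padicValNat_sha_add_le_of_forall_pow_dvd_kuriharaNumber_cyclicLevel)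
    (hCT : exists_casselsTate_pairing (K := ℚ))
    (hGZK : rank_eq_analyticRank_of_analyticRank_le_one) (hmod : hasEntireLFunction_rat)
    (hp : 5 ≤ p) (hr : W.analyticRank = 0) (hsurj : W.HasSurjectiveModNGaloisRep p)
    {N : ℕ} [NeZero N] (D : ModularParametrizationData W N) (hN : W.conductorNorm ℤ = N)
    (hc : ¬ (p : ℤ) ∣ D.maninConstant)
    (hper : ∃ u : ℚ, ‖(u : ℚ_[p])‖ = 1 ∧ W.realPeriodRat = u * plusPeriod D.f)
    {q' : ℚ} (hq' : shaAn W = (q' : ℂ)) (hev : Even (padicValRat p q')) :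
    kuriharaPartialInfty W p D.f ≠ (padicValNat p W.tamagawaProduct + 1 : ℕ) := by
  obtain ⟨q'', d, hq'', hd, heven⟩ :=
    even_padicValRat_shaAn_add_tamagawa_sub_kimDefect_of_kimFacts_of_casselsTate_of_five_le W p hKimk
      hE67c hCT hGZK hmod hp hr hsurj D hN hc hper
  have hqq : q'' = q' := by exact_mod_cast hq''.symm.trans hq'
  subst hqq
  rw [hd]
  intro h
  have hdd : d = padicValNat p W.tamagawaProduct + 1 := by exact_mod_cast h
  obtain ⟨k, hk⟩ := heven
  obtain ⟨m, hm⟩ := hev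
  rw [hdd] at hk
  push_cast at hk
  omega

/-- **… nor by `−1`**: under §1's hypotheses, if `#Ш_an = q'` with `ord_p q'` even then
`∂^{(∞)}(δ̃) + 1 ≠ ord_p ∏_v c_v`. [cite: Kim2022StructureSelmer, Conj. 1.10 (PDF p. 8)]
[cite: SilvermanAEC2009, Thm. X.4.14] -/
theorem kimDefect_add_one_ne_tamagawa_of_kimFacts_of_casselsTate_of_even
    (hKimk : Kim2026.rankZero_le_padicValNat_sha_of_kuriharaNumber_ne_zero)
    (hE67c : Kim2026.rankZero_padicValNat_sha_add_le_of_forall_pow_dvd_kuriharaNumber_cyclicLevel)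
    (hCT : exists_casselsTate_pairing (K := ℚ))
    (hGZK : rank_eq_analyticRank_of_analyticRank_le_one) (hmod : hasEntireLFunction_rat)
    (hp : 5 ≤ p) (hr : W.analyticRank = 0) (hsurj : W.HasSurjectiveModNGaloisRep p)
    {N : ℕ} [NeZero N] (D : ModularParametrizationData W N) (hN : W.conductorNorm ℤ = N)
    (hc : ¬ (p : ℤ) ∣ D.maninConstant)
    (hper : ∃ u : ℚ, ‖(u : ℚ_[p])‖ = 1 ∧ W.realPeriodRat = u * plusPeriod D.f)
    {q' : ℚ} (hq' : shaAn W = (q' : ℂ)) (hev : Even (padicValRat p q')) :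
    kuriharaPartialInfty W p D.f + 1 ≠ (padicValNat p W.tamagawaProduct : ℕ) := by
  obtain ⟨q'', d, hq'', hd, heven⟩ :=
    even_padicValRat_shaAn_add_tamagawa_sub_kimDefect_of_kimFacts_of_casselsTate_of_five_le W p hKimk
      hE67c hCT hGZK hmod hp hr hsurj D hN hc hper
  have hqq : q'' = q' := by exact_mod_cast hq''.symm.trans hq'
  subst hqq
  rw [hd]
  intro h
  have hdd : d + 1 = padicValNat p W.tamagawaProduct := by exact_mod_cast h
  obtain ⟨k, hk⟩ := heven
  obtain ⟨m, hm⟩ := hev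
  rw [← hdd] at hk
  push_cast at hk
  omega

/-! ### §2 One off is enough: each half of the `p`-part of BSD from a one-off relaxation of Conjecture 1.10 -/

/-- **UPPER half from the `≥` half relaxed by one, on an even row.** Under §1's hypotheses, if
`#Ш_an = q'` with `ord_p q'` even and **`ord_p ∏_v c_v ≤ ∂^{(∞)}(δ̃) + 1`**, then
`Typed.MissingUpperBoundAt W p` (`ord_p #Ш ≤ ord_p #Ш_an`): parity upgrades the relaxed inequality to
`ord_p ∏_v c_v ≤ ∂^{(∞)}(δ̃)` = `X4.KimTamagawaDefectGeAt`, which IS the upper half (gen 17's iff).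
[cite: Kim2022StructureSelmer, Thm. 1.9 (6) and Conj. 1.10 (PDF p. 8)] [cite: SilvermanAEC2009, Thm. X.4.14]
[cite: Miller2011LMS, Def. 1.1] -/
theorem missingUpperBoundAt_of_tamagawa_le_kimDefect_add_one_of_even
    (hKimk : Kim2026.rankZero_le_padicValNat_sha_of_kuriharaNumber_ne_zero)
    (hE67c : Kim2026.rankZero_padicValNat_sha_add_le_of_forall_pow_dvd_kuriharaNumber_cyclicLevel)
    (hCT : exists_casselsTate_pairing (K := ℚ))
    (hGZK : rank_eq_analyticRank_of_analyticRank_le_one) (hmod : hasEntireLFunction_rat)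
    (hp : 5 ≤ p) (hr : W.analyticRank = 0) (hsurj : W.HasSurjectiveModNGaloisRep p)
    {N : ℕ} [NeZero N] (D : ModularParametrizationData W N) (hN : W.conductorNorm ℤ = N)
    (hc : ¬ (p : ℤ) ∣ D.maninConstant)
    (hper : ∃ u : ℚ, ‖(u : ℚ_[p])‖ = 1 ∧ W.realPeriodRat = u * plusPeriod D.f)
    {q' : ℚ} (hq' : shaAn W = (q' : ℂ)) (hev : Even (padicValRat p q'))
    (hge : (padicValNat p W.tamagawaProduct : ℕ∞) ≤ kuriharaPartialInfty W p D.f + 1) :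
    MissingUpperBoundAt W p := by
  obtain ⟨q'', d, hq'', hd, heven⟩ :=
    even_padicValRat_shaAn_add_tamagawa_sub_kimDefect_of_kimFacts_of_casselsTate_of_five_le W p hKimk
      hE67c hCT hGZK hmod hp hr hsurj D hN hc hper
  have hqq : q'' = q' := by exact_mod_cast hq''.symm.trans hq'
  subst hqq
  rw [missingUpperBoundAt_iff_kimTamagawaDefectGeAt_of_kimFacts_of_five_le W p hKimk hE67c hGZK hmod hp
    hr hsurj D hN hc hper, KimTamagawaDefectGeAt, hd, ENat.coe_le_coe]
  rw [hd] at hge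
  have hge' : (padicValNat p W.tamagawaProduct : ℤ) ≤ d + 1 := by exact_mod_cast hge
  have hev' : Even ((padicValNat p W.tamagawaProduct : ℤ) - d) := by
    obtain ⟨k, hk⟩ := heven
    obtain ⟨m, hm⟩ := hev
    exact ⟨k - m, by omega⟩
  exact_mod_cast Int.le_of_le_add_one_of_even_sub hge' hev'

/-- **LOWER half from the `≤` half relaxed by one, on an even row.** Under §1's hypotheses, if
`#Ш_an = q'` with `ord_p q'` even and **`∂^{(∞)}(δ̃) ≤ ord_p ∏_v c_v + 1`**, then
`Typed.MissingLowerBoundAt W p` (`ord_p #Ш_an ≤ ord_p #Ш`): parity upgrades to `X4.KimTamagawaDefectLeAt`.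
[cite: Kim2022StructureSelmer, Thm. 1.9 (6) and Conj. 1.10 (PDF p. 8)] [cite: SilvermanAEC2009, Thm. X.4.14]
[cite: Miller2011LMS, Def. 1.1] -/
theorem missingLowerBoundAt_of_kimDefect_le_tamagawa_add_one_of_even
    (hKimk : Kim2026.rankZero_le_padicValNat_sha_of_kuriharaNumber_ne_zero)
    (hE67c : Kim2026.rankZero_padicValNat_sha_add_le_of_forall_pow_dvd_kuriharaNumber_cyclicLevel)
    (hCT : exists_casselsTate_pairing (K := ℚ))
    (hGZK : rank_eq_analyticRank_of_analyticRank_le_one) (hmod : hasEntireLFunction_rat)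
    (hp : 5 ≤ p) (hr : W.analyticRank = 0) (hsurj : W.HasSurjectiveModNGaloisRep p)
    {N : ℕ} [NeZero N] (D : ModularParametrizationData W N) (hN : W.conductorNorm ℤ = N)
    (hc : ¬ (p : ℤ) ∣ D.maninConstant)
    (hper : ∃ u : ℚ, ‖(u : ℚ_[p])‖ = 1 ∧ W.realPeriodRat = u * plusPeriod D.f)
    {q' : ℚ} (hq' : shaAn W = (q' : ℂ)) (hev : Even (padicValRat p q'))
    (hle : kuriharaPartialInfty W p D.f ≤ (padicValNat p W.tamagawaProduct + 1 : ℕ)) :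
    MissingLowerBoundAt W p := by
  obtain ⟨q'', d, hq'', hd, heven⟩ :=
    even_padicValRat_shaAn_add_tamagawa_sub_kimDefect_of_kimFacts_of_casselsTate_of_five_le W p hKimk
      hE67c hCT hGZK hmod hp hr hsurj D hN hc hper
  have hqq : q'' = q' := by exact_mod_cast hq''.symm.trans hq'
  subst hqq
  rw [missingLowerBoundAt_iff_kimTamagawaDefectLeAt_of_kimFacts_of_five_le W p hKimk hE67c hGZK hmod hp
    hr hsurj D hN hc hper, KimTamagawaDefectLeAt, hd, ENat.coe_le_coe]
  rw [hd] at hle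
  have hle' : (d : ℤ) ≤ padicValNat p W.tamagawaProduct + 1 := by exact_mod_cast hle
  have hev' : Even ((d : ℤ) - padicValNat p W.tamagawaProduct) := by
    obtain ⟨k, hk⟩ := heven
    obtain ⟨m, hm⟩ := hev
    exact ⟨m - k, by omega⟩
  exact_mod_cast Int.le_of_le_add_one_of_even_sub hle' hev'

/-- **The `p`-part from Conjecture 1.10 WITHIN ONE, on an even row**: `#Ш_an = q'` with `ord_p q'`
even and `|∂^{(∞)}(δ̃) − ord_p ∏_v c_v| ≤ 1` (both one-off inequalities) ⟹ `Typed.MissingPPartAt W p`,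
hence `BSD(E,p)` by `Typed.bsdp_of_missingPPartAt`. [cite: Kim2022StructureSelmer, Thm. 1.9 (6) and Conj. 1.10 (PDF p. 8)]
[cite: SilvermanAEC2009, Thm. X.4.14] [cite: Miller2011LMS, §1 and Def. 1.1] -/
theorem missingPPartAt_of_kimDefect_within_one_of_even
    (hKimk : Kim2026.rankZero_le_padicValNat_sha_of_kuriharaNumber_ne_zero)
    (hE67c : Kim2026.rankZero_padicValNat_sha_add_le_of_forall_pow_dvd_kuriharaNumber_cyclicLevel)
    (hCT : exists_casselsTate_pairing (K := ℚ))
    (hGZK : rank_eq_analyticRank_of_analyticRank_le_one) (hmod : hasEntireLFunction_rat)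
    (hp : 5 ≤ p) (hr : W.analyticRank = 0) (hsurj : W.HasSurjectiveModNGaloisRep p)
    {N : ℕ} [NeZero N] (D : ModularParametrizationData W N) (hN : W.conductorNorm ℤ = N)
    (hc : ¬ (p : ℤ) ∣ D.maninConstant)
    (hper : ∃ u : ℚ, ‖(u : ℚ_[p])‖ = 1 ∧ W.realPeriodRat = u * plusPeriod D.f)
    {q' : ℚ} (hq' : shaAn W = (q' : ℂ)) (hev : Even (padicValRat p q'))
    (hge : (padicValNat p W.tamagawaProduct : ℕ∞) ≤ kuriharaPartialInfty W p D.f + 1)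
    (hle : kuriharaPartialInfty W p D.f ≤ (padicValNat p W.tamagawaProduct + 1 : ℕ)) :
    MissingPPartAt W p :=
  missingPPartAt_of_lower_of_upper W p
    (missingLowerBoundAt_of_kimDefect_le_tamagawa_add_one_of_even W p hKimk hE67c hCT hGZK hmod hp hr
      hsurj D hN hc hper hq' hev hle)
    (missingUpperBoundAt_of_tamagawa_le_kimDefect_add_one_of_even W p hKimk hE67c hCT hGZK hmod hp hr
      hsurj D hN hc hper hq' hev hge)

/-- **Typed vocabulary: the `≥` half of Conjecture 1.10 FOLLOWS from its one-off relaxation on an even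
row** — `ord_p ∏_v c_v ≤ ∂^{(∞)}(δ̃) + 1 ⟹ X4.KimTamagawaDefectGeAt W p D.f` (`#Ш_an = q'`, `ord_p q'`
even). So on the TAM-DEFECT₂♭ rows (the `≥` half missing) only every OTHER value of `∂^{(∞)}` is in
doubt. [cite: Kim2022StructureSelmer, Conj. 1.10 (PDF p. 8)] [cite: SilvermanAEC2009, Thm. X.4.14] -/
theorem kimTamagawaDefectGeAt_of_tamagawa_le_add_one_of_even
    (hKimk : Kim2026.rankZero_le_padicValNat_sha_of_kuriharaNumber_ne_zero)
    (hE67c : Kim2026.rankZero_padicValNat_sha_add_le_of_forall_pow_dvd_kuriharaNumber_cyclicLevel)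
    (hCT : exists_casselsTate_pairing (K := ℚ))
    (hGZK : rank_eq_analyticRank_of_analyticRank_le_one) (hmod : hasEntireLFunction_rat)
    (hp : 5 ≤ p) (hr : W.analyticRank = 0) (hsurj : W.HasSurjectiveModNGaloisRep p)
    {N : ℕ} [NeZero N] (D : ModularParametrizationData W N) (hN : W.conductorNorm ℤ = N)
    (hc : ¬ (p : ℤ) ∣ D.maninConstant)
    (hper : ∃ u : ℚ, ‖(u : ℚ_[p])‖ = 1 ∧ W.realPeriodRat = u * plusPeriod D.f)
    {q' : ℚ} (hq' : shaAn W = (q' : ℂ)) (hev : Even (padicValRat p q'))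
    (hge : (padicValNat p W.tamagawaProduct : ℕ∞) ≤ kuriharaPartialInfty W p D.f + 1) :
    KimTamagawaDefectGeAt W p D.f :=
  (missingUpperBoundAt_iff_kimTamagawaDefectGeAt_of_kimFacts_of_five_le W p hKimk hE67c hGZK hmod hp hr
    hsurj D hN hc hper).mp
    (missingUpperBoundAt_of_tamagawa_le_kimDefect_add_one_of_even W p hKimk hE67c hCT hGZK hmod hp hr
      hsurj D hN hc hper hq' hev hge)

/-! ### §3 The ONE-FACTOR socket for the TAM-DEFECT₂♭ rows (`p ∤ #Ш_an`) -/

/-- **THE ONE-FACTOR SOCKET.** Under §1's hypotheses on a `p ∤ #Ш_an` row (`#Ш_an = q'`,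
`ord_p q' = 0`): ANY lower bound `α ≤ ∂^{(∞)}(δ̃_{D.f})` with **`ord_p ∏_v c_v ≤ α + 1`** gives
`BSD(E,p)`. (The lower half is automatic on such rows; the upper half is §2 with `0` even.) With
`α = ord_p ∏_v c_v` this is the unit-free `≥` half of Conjecture 1.10; with `α = max_{ℓ ≠ p} ord_p c_ℓ`
it is the ONE-FACTOR bound that Büyükboduk 2009 Cor. 3.3 read through Kim's Thm. 3.13 would supply
on the `t = 0` rows (a composite READING, NOT assumed here and NOT a theorem of either source) —
then the binder says "at most one `p` among the `c_ℓ` outside the dominant one". Census (seat file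
V26-YIELD.tsv): window 2/2, sweep 172/177 of the TAM-DEFECT₂♭ rows at `p ≥ 5` have that shape.
EVIDENCE only; X4 stays CONSTRUCTION-SHAPED; nothing booked.
[cite: Kim2022StructureSelmer, Thm. 1.9 (6) and Conj. 1.10 (PDF p. 8), Thm. 3.13 (PDF p. 17), Rem. 6.2 (PDF p. 31)]
[cite: SilvermanAEC2009, Thm. X.4.14] [cite: Miller2011LMS, §1 and Def. 1.1] -/
theorem bsdp_of_le_kimDefect_of_tamagawa_le_add_one_of_shaAn_unit
    (hKimk : Kim2026.rankZero_le_padicValNat_sha_of_kuriharaNumber_ne_zero)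
    (hE67c : Kim2026.rankZero_padicValNat_sha_add_le_of_forall_pow_dvd_kuriharaNumber_cyclicLevel)
    (hCT : exists_casselsTate_pairing (K := ℚ))
    (hGZK : rank_eq_analyticRank_of_analyticRank_le_one) (hmod : hasEntireLFunction_rat)
    (hp : 5 ≤ p) (hr : W.analyticRank = 0) (hsurj : W.HasSurjectiveModNGaloisRep p)
    {N : ℕ} [NeZero N] (D : ModularParametrizationData W N) (hN : W.conductorNorm ℤ = N)
    (hc : ¬ (p : ℤ) ∣ D.maninConstant)
    (hper : ∃ u : ℚ, ‖(u : ℚ_[p])‖ = 1 ∧ W.realPeriodRat = u * plusPeriod D.f)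
    {q' : ℚ} (hq' : shaAn W = (q' : ℂ)) (hv : padicValRat p q' = 0)
    {α : ℕ} (hα : (α : ℕ∞) ≤ kuriharaPartialInfty W p D.f)
    (htam : padicValNat p W.tamagawaProduct ≤ α + 1) : BSDp W p := by
  have hL : W.entireLFunction 1 ≠ 0 := (W.analyticRank_eq_zero_iff_holds (hmod W)).mp hr
  obtain ⟨hmw, hfin⟩ := hGZK W (by rw [hr]; exact zero_le_one)
  haveI : Finite W.sha := hfin
  have hev : Even (padicValRat p q') := by rw [hv]; exact ⟨0, rfl⟩
  -- upper half: `ord_p ∏c ≤ α + 1 ≤ ∂^{(∞)} + 1`, then parity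
  have hge : (padicValNat p W.tamagawaProduct : ℕ∞) ≤ kuriharaPartialInfty W p D.f + 1 := by
    calc (padicValNat p W.tamagawaProduct : ℕ∞) ≤ ((α + 1 : ℕ) : ℕ∞) := by exact_mod_cast htam
      _ = (α : ℕ∞) + 1 := by push_cast; rfl
      _ ≤ kuriharaPartialInfty W p D.f + 1 := add_le_add hα le_rfl
  have hup := missingUpperBoundAt_of_tamagawa_le_kimDefect_add_one_of_even W p hKimk hE67c hCT hGZK hmod
    hp hr hsurj D hN hc hper hq' hev hge
  -- lower half: automatic on a `p ∤ #Ш_an` row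
  have hlow : MissingLowerBoundAt W p := ⟨q', hq', by rw [hv]; exact_mod_cast Nat.zero_le _⟩
  exact bsdp_of_missingPPartAt W p hGZK (by rw [hr]; exact zero_le_one)
    (missingPPartAt_of_lower_of_upper W p hlow hup)

/-! ### §4 OPTIMAL data: the period transfer discharged -/

/-- **The ONE-FACTOR socket on an OPTIMAL datum**: `p ≥ 5` surjective, analytic rank `0`, optimal
conductor-level `D` with `p ∤ c`, `p ∤ #Ш_an`, and some `α ≤ ∂^{(∞)}(δ̃_{D.f})` with
`ord_p ∏_v c_v ≤ α + 1` ⟹ `BSD(E,p)`. The census shape of §3 (one `surj(p)` bit, one class integer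
`c`, Cremona optimality, the Tamagawa list, and the socket value `α`).
[cite: Kim2022StructureSelmer, Thm. 1.9 (6) and Conj. 1.10 (PDF p. 8)] [cite: SilvermanAEC2009, Thm. X.4.14]
[cite: Miller2011LMS, §1 and Def. 1.1] [cite: CremonaAlgorithms1997, §2.8 (p. 26)] -/
theorem bsdp_of_le_kimDefect_of_tamagawa_le_add_one_of_shaAn_unit_of_optimal
    (hKimk : Kim2026.rankZero_le_padicValNat_sha_of_kuriharaNumber_ne_zero)
    (hE67c : Kim2026.rankZero_padicValNat_sha_add_le_of_forall_pow_dvd_kuriharaNumber_cyclicLevel)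
    (hCT : exists_casselsTate_pairing (K := ℚ))
    (hGZK : rank_eq_analyticRank_of_analyticRank_le_one) (hmod : hasEntireLFunction_rat)
    (hp : 5 ≤ p) (hr : W.analyticRank = 0) (hsurj : W.HasSurjectiveModNGaloisRep p)
    {N : ℕ} [NeZero N] (D : ModularParametrizationData W N) (hN : W.conductorNorm ℤ = N)
    (hopt : ∀ z ∈ D.L.lattice, ∃ w ∈ periodLattice D.f, z = D.c * w)
    (hc : ¬ (p : ℤ) ∣ D.maninConstant)
    {q' : ℚ} (hq' : shaAn W = (q' : ℂ)) (hv : padicValRat p q' = 0)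
    {α : ℕ} (hα : (α : ℕ∞) ≤ kuriharaPartialInfty W p D.f)
    (htam : padicValNat p W.tamagawaProduct ≤ α + 1) : BSDp W p :=
  bsdp_of_le_kimDefect_of_tamagawa_le_add_one_of_shaAn_unit W p hKimk hE67c hCT hGZK hmod hp hr hsurj D
    hN hc (periodTransfer_of_optimal p D hopt hc) hq' hv hα htam

end Summit.BirchSwinnertonDyer.Rank1Residual.X4

end
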